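import Summits.Ventures.CertifiedManyBodySolver.Downfold.EmeryOrbitalWeightAxisWindow
import Summits.Ventures.CertifiedManyBodySolver.Downfold.EmeryVanHoveSubBox
import Summits.Ventures.CertifiedManyBodySolver.Downfold.EmeryVanHoveTableK768A
import Summits.Ventures.CertifiedManyBodySolver.Downfold.EmeryScaleBoxLa214SOLX022Pts
import HarnessLib

/-!
# THE OVERDOPED COLUMN OF THE WORKED EXAMPLE, I: every SOLVER-LEVEL member of the La₂₋ₓSrₓCuO₄ box #18 (Δ_pd tag sub-box [3.24, 4.0]) is ELECTRON-LIKE at x = 0.22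
# (ν = 39/100) — decided on the K = 768 grid — and its axis-antinode Cu-d weight lies in `[0.7616, 0.8359]` (INFL-3to1-B §B.92)

Venture CertifiedManyBodySolver, cell `pub/hubbard-downfold` (stage S1), seat hubbard-downfold-mod-4 (technique B, g41); namespace
`Summit.Ventures.CertifiedManyBodySolver.Downfold.Emery`. Everything PROVED (0 sorry; one `vhBoxCheck` by `decide +kernel`; the K = 768 Ψ-table entry `vhFracK768_4847_10000`
(`EmeryVanHoveTableK768A`); the landed K = 384 corner brackets `scalePt_La214SOLX022_TP_br` / `_FL_br`; closed forms by `norm_num [dWeightAxisCF]`). WHY: router/EMERY-FS-WEIGHT-BRACKETS.tsv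
carried the La214{ALL,DFT,SOL} x = 0.22 rows as «beyond x_VH window» — the §B.62 van Hove (Lifshitz) hole doping of the typed box, x_VH ∈ [0.1344, 0.2721] over Δ_pd ∈ [1.7, 4.0],
brackets x = 0.22, so no single antinode type exists over the WHOLE box and the one-band image of the overdoped LSCO column (M17) stayed without its fourth coordinate. For the
SOLVER-LEVEL sub-box `Δ_pd ∈ [3.24, 4.0] × t_pd ∈ [1.29, 1.52] × t_pp ∈ [0.46, 0.66] × t_pp′ ∈ [0.12, 0.15]` the corner-exact box rule `xVH_window_of_vhBoxCheck` gives
`x_VH(θ) ≤ 1 − 2Ψ(4847/10000)` for every member; at the K = 384 table resolution `Ψ ≥ 0.3899` (`vhFrac_97_200`) ⇒ `x_VH ≤ 0.2202` — NOT below 0.22; on the K = 768 grid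
`Ψ(4847/10000) ≥ 230730/589824 = 0.39118` ⇒ **`x_VH(θ) ≤ 0.21764 < 0.22`** ⇒ (`EmeryOrbitalWeightAxisWindow.electronLike_of_xVH_le`) **every solver-level member is ELECTRON-LIKE at
x = 0.22: `faceG(θ; ε_F) < 0`, `xAxis(θ; ε_F) < 1`** — its Fermi surface is closed around Γ and its most Cu-like point is the Γ–X axis crossing, whose weight the two-corner rule
`dWeightAxis_fermiEnergyOf_mem_Icc_of_mem_box_num` windows: **`w_axis ∈ [0.7616, 0.8359]`** (floor at (Δ₁, a₂, c₁; E_h = 1.6929), ceiling at (Δ₂, a₁, c₂; E_l = 1.118); the ceiling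
= the §B.90 (e) universal value of this row). The DFT-level sub-box and the whole box STRADDLE their Lifshitz filling at x = 0.22 (companion file `EmeryBoxesLa214LifshitzX022`).
WHAT THIS IS NOT: a statement about the material (La₂₋ₓSrₓCuO₄ x = 0.22, column M17 of box #18) — the typed box `emeryBoxLa214v123` and its Δ_pd level tags (La2CuO4-family.md
§OF-RECORD) are SCREENING-GRADE; `U = 0` one-body kinematics of the σ model; no U number. Comparator [float, not ours]: LSCO ARPES places the Lifshitz (hole- → electron-like)
crossing near x ≈ 0.17–0.22.

Sources: three-band model [HybertsenSchluterChristensen1989, Eq. (1)]; [AndersenEtAl1995, §6]; [folklore] algebra.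
-/

noncomputable section

namespace Summit.Ventures.CertifiedManyBodySolver.Downfold.Emery

open Real Set

/-- The van Hove box check of the solver-level sub-box (Δ ∈ [3.24, 4.0], t_pd ∈ [1.29, 1.52], t_pp ∈ [0.46, 0.66], t_pp′ ∈ [0.12, 0.15]): ε_VH-brackets, `Δ + ε_VH` brackets,
`q ∈ [1267/5000, 4847/10000]`, separation margin (lifshitz-g41/gen/vhlibK.py ∘ vh-g20/vhlib.box_cert). [folklore] -/
theorem la214SOLBox_vhBoxCheck :
    vhBoxCheck ((81 : ℚ) / 25) 4 ((129 : ℚ) / 100) ((38 : ℚ) / 25) ((23 : ℚ) / 50) ((33 : ℚ) / 50) ((3 : ℚ) / 25) ((3 : ℚ) / 20)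
      ((11563 : ℚ) / 10000) ((17039 : ℚ) / 10000) ((162 : ℚ) / 125) ((7681 : ℚ) / 5000) ((1267 : ℚ) / 5000) ((4847 : ℚ) / 10000) = true := by
  decide +kernel

/-- **Solver-level sub-box of `emeryBoxLa214v123` (Δ_pd ∈ [3.24, 4.0]): for EVERY member `x_VH(θ) ≤ 1 − 2·(230730/589824) = 0.21764`** (corner-exact box rule + the K = 768 table
entry `vhFracK768_4847_10000`). [folklore] -/
theorem la214SOLBox_xVH_le {Δ a b c : ℝ} (hΔ : Δ ∈ Icc ((81 : ℝ) / 25) (4 : ℝ)) (ha : a ∈ Icc ((129 : ℝ) / 100) ((38 : ℝ) / 25))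
    (hb : b ∈ Icc ((23 : ℝ) / 50) ((33 : ℝ) / 50)) (hc : c ∈ Icc ((3 : ℝ) / 25) ((3 : ℝ) / 20)) :
    xVH Δ a b c ≤ 1 - 2 * ((230730 : ℝ) / 589824) := by
  have h := xVH_window_of_vhBoxCheck la214SOLBox_vhBoxCheck (Δ := Δ) (tpd := a) (tpp := b) (c := c)
    (by push_cast; simpa using hΔ) (by push_cast; simpa using ha) (by push_cast; simpa using hb) (by push_cast; simpa using hc)
  obtain ⟨-, -, -, -, -, hwin⟩ := h
  push_cast at hwin
  have ht := vhFracK768_4847_10000.1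
  linarith [hwin.2]

/-- **EVERY SOLVER-LEVEL MEMBER IS ELECTRON-LIKE AT x = 0.22 (ν = 39/100)**: `faceG(θ; ε_F(θ; 39/100)) < 0` and `xAxis(θ; ε_F) < 1` — the antibonding band reaches ε_F on the
Γ–X axis; the Fermi surface is closed around Γ. [folklore] -/
theorem la214SOLBox_electronLike_x022 {Δ a b c : ℝ} (hΔ : Δ ∈ Icc ((81 : ℝ) / 25) (4 : ℝ)) (ha : a ∈ Icc ((129 : ℝ) / 100) ((38 : ℝ) / 25))
    (hb : b ∈ Icc ((23 : ℝ) / 50) ((33 : ℝ) / 50)) (hc : c ∈ Icc ((3 : ℝ) / 25) ((3 : ℝ) / 20)) :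
    faceG Δ a c (fermiEnergyOf Δ a b c ((39 : ℝ) / 100)) < 0 ∧ xAxis Δ a c (fermiEnergyOf Δ a b c ((39 : ℝ) / 100)) < 1 := by
  have hΔ0 : 0 < Δ := lt_of_lt_of_le (by norm_num) hΔ.1
  have ha0 : 0 < a := lt_of_lt_of_le (by norm_num) ha.1
  have hc0 : 0 ≤ c := le_trans (by norm_num) hc.1
  have hb0 : 0 ≤ b := le_trans (by norm_num) hb.1
  have hT := (fermiEnergyOf_of_pointBracketCheck scalePt_La214SOLX022_TP_br (by norm_num) (by norm_num) (by norm_num) (ν := (39/100 : ℝ))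
    (by push_cast; exact ⟨le_rfl, le_rfl⟩)).2
  push_cast at hT
  have hbox := fermiEnergyOf_mem_Icc_of_mem_box' (ν := ((39 : ℝ) / 100)) (by norm_num) (by norm_num) (by norm_num) (by norm_num) hΔ ha hb hc (by norm_num) (by norm_num)
  have hν : ((39 : ℝ) / 100) = (39/100 : ℝ) := by norm_num
  have hEh : fermiEnergyOf Δ a b c ((39 : ℝ) / 100) ≤ (16929 : ℝ) / 10000 := by
    refine hbox.2.trans ?_
    rw [hν]; exact hT.2
  exact electronLike_of_xVH_le (X := 1 - 2 * ((230730 : ℝ) / 589824)) (c₂ := (3 : ℝ) / 20) (a₁ := (129 : ℝ) / 100) hΔ0 ha0 hc0 hb0 (by norm_num) (by norm_num)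
    (la214SOLBox_xVH_le hΔ ha hb hc) (by norm_num) hEh hc.2 ha.1 (by norm_num) (by norm_num)

/-- **THE AXIS-ANTINODE Cu-d WEIGHT WINDOW of the solver-level sub-box at x = 0.22**: for EVERY member `w_axis(θ; ε_F(θ; 39/100)) ∈ [0.7616, 0.8359]` — by
`la214SOLBox_electronLike_x022` this is the weight of the member's most Cu-like Fermi point. Two-corner rule: floor at (Δ₁, a₂, c₁; E_h = 1.6929) (`scalePt_La214SOLX022_TP_br`),
ceiling at (Δ₂, a₁, c₂; E_l = 1.118) (`scalePt_La214SOLX022_FL_br`). [folklore] -/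
theorem la214SOLBox_axisAntinode_x022 {Δ a b c : ℝ} (hΔ : Δ ∈ Icc ((81 : ℝ) / 25) (4 : ℝ)) (ha : a ∈ Icc ((129 : ℝ) / 100) ((38 : ℝ) / 25))
    (hb : b ∈ Icc ((23 : ℝ) / 50) ((33 : ℝ) / 50)) (hc : c ∈ Icc ((3 : ℝ) / 25) ((3 : ℝ) / 20)) :
    dWeightAxis Δ a b c (fermiEnergyOf Δ a b c ((39 : ℝ) / 100)) ∈ Icc ((7616 : ℝ) / 10000) ((8359 : ℝ) / 10000) := by
  have hT := (fermiEnergyOf_of_pointBracketCheck scalePt_La214SOLX022_TP_br (by norm_num) (by norm_num) (by norm_num) (ν := (39/100 : ℝ))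
    (by push_cast; exact ⟨le_rfl, le_rfl⟩)).2
  have hF := (fermiEnergyOf_of_pointBracketCheck scalePt_La214SOLX022_FL_br (by norm_num) (by norm_num) (by norm_num) (ν := (39/100 : ℝ))
    (by push_cast; exact ⟨le_rfl, le_rfl⟩)).2
  push_cast at hT hF
  have hν : ((39 : ℝ) / 100) = (39/100 : ℝ) := by norm_num
  rw [hν]
  exact dWeightAxis_fermiEnergyOf_mem_Icc_of_mem_box_num (El := (559 : ℝ) / 500) (Eh := (16929 : ℝ) / 10000) (by norm_num) (by norm_num) (by norm_num) (by norm_num)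
    hΔ ha hb hc (by norm_num) (by norm_num) (by norm_num) hF.1 hT.2 (by norm_num) (by norm_num) (by norm_num [dWeightAxisCF]) (by norm_num [dWeightAxisCF])

end Summit.Ventures.CertifiedManyBodySolver.Downfold.Emery
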